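import Literature.Computability.QuantumComplexity.HidingIdealMoments
import Literature.Analysis.Matrix.GramSchmidtIntegerColumns
import HarnessLib

/-!
# The ideal world of the proof of AA13 Thm. 1.3: the array events and their probabilities

Family `quantum-advantage`, sequel of `HidingIdealMoments.lean`. In the ideal world the data are a
uniformly random array `W ∈ A^{M×n}` over the entry alphabet (`M = m` rows), uniformly random
positions `S : Fin n → Fin M` and the counter's coins; this file bounds the three ARRAY events of
the union bound of the discharge of Aaronson–Arkhipov's Thm. 1.3 as fractions of the finite sample
space:

* `yMat P W` — the Gaussian-integer matrix of the array; `GramGood` — its Gram matrix is within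
  `t M s` of `M s · 1`; **`card_not_gramGood_le`** (Chebyshev, `rectExpect_exists_gram_far_le`):
  fraction `≤ n² · 4M(M₄ + s²)/(tMs)²`;
* **`card_inj_planted_le`** — for a property of the planted block `W ∘ S` and injective `S`, the
  fraction of `(S, W)` is the square product-law probability (`rectExpect_comp_rows`);
* **`card_inj_perturb_le`** — `Z ≤ Z_η(Y_S)` has fraction `≤ 4η²n⁶ sⁿ n!/Z²`
  (`arrayExpect_perturbSum_sq_le` + Markov); **`card_inj_perm_le`** — `P_b ≤ |Per Y_S|²` has
  fraction `≤ sⁿ n!/P_b` (`arrayExpect_norm_permanent_sq_le` + Markov);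
* `card_not_injective_mul_le` — non-injective positions: fraction `≤ n²/M`.

All proved, no new named facts.

## References

* S. Aaronson, A. Arkhipov, *The computational complexity of linear optics*, Theory of Computing 9
  (2013) 143–252, proof of Thm. 1.3, §5.2 (pp. 192–195); §7 (moments of the permanent).
-/

noncomputable section

namespace Literature.Computability.QuantumComplexity

open Finset Matrix Literature.Computability.Complexity Literature.Probability.Distributions
  Literature.Probability.Moments Literature.LinearAlgebra.Matrix Literature.Analysis.Matrix

variable (P : PGParams) {M n : ℕ}

/-! ### The matrix of an array -/

/-- The integer-pair entries of an array over the entry alphabet. [folklore] -/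
def entryArr (W : Fin M → Fin n → EntryBlock P) (r : Fin M) (c : Fin n) : ℤ × ℤ := entryOfCoins P (W r c).toList

/-- **The Gaussian-integer matrix of an array**: `(yMat W) r c = y(W r c)`. [folklore] -/
def yMat (W : Fin M → Fin n → EntryBlock P) : _root_.Matrix (Fin M) (Fin n) ℂ := gaussIntMatrix (entryArr P W)

/-- Entries of `yMat`. [folklore] -/
@[simp] theorem yMat_apply (W : Fin M → Fin n → EntryBlock P) (r : Fin M) (c : Fin n) : yMat P W r c = yOf P (W r c) := rfl

/-- The planted block of the matrix is the seed matrix of the planted rows. [folklore] -/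
theorem yMat_submatrix (W : Fin M → Fin n → EntryBlock P) (S : Fin n → Fin M) :
    (yMat P W).submatrix S id = seedMatrix (yOf P) (fun i => W (S i)) := by
  ext i j; rfl

/-- The Gram entries of the array are the entries of `Bᴴ B`. [folklore] -/
theorem gramEntry_eq (W : Fin M → Fin n → EntryBlock P) (j k : Fin n) :
    gramEntry (yOf P) W j k = ((yMat P W)ᴴ * yMat P W) j k := by
  simp [gramEntry, Matrix.mul_apply, Matrix.conjTranspose_apply]

/-! ### The Gram event -/

/-- **The Gram matrix is near `M s · 1`**: `‖(Bᴴ B) j k - M s δ_{jk}‖ ≤ t M s` for all `j, k`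
(the hypothesis of `GramSchmidtNearIdentity.lean` with `N = M s`). [folklore] -/
def GramGood (t s : ℝ) (W : Fin M → Fin n → EntryBlock P) : Prop :=
  ∀ j k, ‖((yMat P W)ᴴ * yMat P W) j k - (if j = k then ((M : ℂ) * (s : ℂ)) else 0)‖ ≤ t * (M * s)

/-- The Gram hypothesis in the form of `GramSchmidtNearIdentity.lean`. [folklore] -/
theorem GramGood.hG {t s : ℝ} {W : Fin M → Fin n → EntryBlock P} (h : GramGood P t s W) :
    ∀ j k, ‖((yMat P W)ᴴ * yMat P W) j k - (if j = k then (((M : ℝ) * s : ℝ) : ℂ) else 0)‖ ≤ t * ((M : ℝ) * s) := by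
  intro j k
  have := h j k
  push_cast at this ⊢
  exact this

open Classical in
/-- **The Gram event fails rarely** (Chebyshev on each entry and the union bound):
`#{W | ¬ GramGood} ≤ n² · 4M(M₄ + s²)/(tMs)² · #arrays`. [cite: AaronsonArkhipovToC2013, proof of Thm. 1.3, §5.2] -/
theorem card_not_gramGood_le {t : ℝ} (ht : 0 < t) (hM : 0 < M) (hs : 0 < 2 * (4 : ℝ) ^ P.b * P.v) {M4 : ℝ}
    (hM4 : ∑ a, unifW P a * ‖yOf P a‖ ^ 4 = M4) :
    ((univ.filter fun W : Fin M → Fin n → EntryBlock P => ¬ GramGood P t (2 * 4 ^ P.b * P.v) W).card : ℝ) ≤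
      (n : ℝ) ^ 2 * (4 * M * (M4 + (2 * 4 ^ P.b * P.v) ^ 2)) / (t * (M * (2 * 4 ^ P.b * P.v))) ^ 2 *
        Fintype.card (Fin M → Fin n → EntryBlock P) := by
  set s : ℝ := 2 * 4 ^ P.b * P.v with hs_def
  have ha : 0 < t * (M * s) := by positivity
  have h := rectExpect_exists_gram_far_le (m := M) (n := n) (unifW P) (unifW_nonneg P) (sum_unifW P) (yOf P)
    (sum_unifW_mul_yOf P) (sum_unifW_mul_norm_yOf_sq P) hM4 ha
  have hmono : rectExpect (unifW P) (fun W : Fin M → Fin n → EntryBlock P => if ¬ GramGood P t s W then (1 : ℝ) else 0) ≤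
      rectExpect (unifW P) (fun W : Fin M → Fin n → EntryBlock P =>
        if ∃ j k : Fin n, t * (M * s) ≤ ‖gramEntry (yOf P) W j k - (if j = k then ((M : ℂ) * (s : ℂ)) else 0)‖
        then (1 : ℝ) else 0) := by
    refine rectExpect_mono (unifW_nonneg P) fun W => ?_
    by_cases hW : GramGood P t s W
    · simp only [hW, not_true_eq_false, if_false]; positivity
    · rw [if_pos hW, if_pos]
      simp only [GramGood, not_forall, not_le] at hW
      obtain ⟨j, k, hjk⟩ := hW
      exact ⟨j, k, by rw [gramEntry_eq]; exact hjk.le⟩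
  have h2 := hmono.trans h
  rw [rectExpect_unif_ite, div_le_iff₀ (by exact_mod_cast Fintype.card_pos)] at h2
  exact h2

/-! ### Events of the planted block -/

open Classical in
/-- **Planted-block events under injective positions see the square product law**: if the
square-array probability of `R` is `≤ c`, then the fraction of pairs `(S, W)` with `S` injective
and `R (W ∘ S)` is `≤ c`. [folklore] -/
theorem card_inj_planted_le (R : (Fin n → Fin n → EntryBlock P) → Prop) {c : ℝ} (hc : 0 ≤ c)
    (hR : arrayExpect (unifW P) (fun ω => if R ω then (1 : ℝ) else 0) ≤ c) :
    ((univ.filter fun q : (Fin n → Fin M) × (Fin M → Fin n → EntryBlock P) =>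
        Function.Injective q.1 ∧ R (fun i => q.2 (q.1 i))).card : ℝ) ≤
      c * Fintype.card ((Fin n → Fin M) × (Fin M → Fin n → EntryBlock P)) := by
  -- slice by `S`
  have hslice : ((univ.filter fun q : (Fin n → Fin M) × (Fin M → Fin n → EntryBlock P) =>
      Function.Injective q.1 ∧ R (fun i => q.2 (q.1 i))).card : ℝ) =
      ∑ S : Fin n → Fin M, ((univ.filter fun W : Fin M → Fin n → EntryBlock P =>
        Function.Injective S ∧ R (fun i => W (S i))).card : ℝ) := by
    rw [card_filter, Fintype.sum_prod_type]
    push_cast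
    refine Finset.sum_congr rfl fun S _ => ?_
    rw [card_filter]
    push_cast
    rfl
  rw [hslice, Fintype.card_prod, Nat.cast_mul, ← mul_assoc, mul_comm c, mul_assoc,
    show (Fintype.card (Fin n → Fin M) : ℝ) = ∑ _S : Fin n → Fin M, (1 : ℝ) by simp, Finset.sum_mul]
  refine Finset.sum_le_sum fun S _ => ?_
  by_cases hS : Function.Injective S
  · have hW : ((univ.filter fun W : Fin M → Fin n → EntryBlock P => Function.Injective S ∧ R (fun i => W (S i))).card : ℝ) =
        rectExpect (unifW P) (fun W : Fin M → Fin n → EntryBlock P => if R (fun i => W (S i)) then (1 : ℝ) else 0) *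
          Fintype.card (Fin M → Fin n → EntryBlock P) := by
      rw [rectExpect_unif_ite, div_mul_cancel₀ _ (by exact_mod_cast Fintype.card_pos.ne')]
      congr 2
      ext W
      simp [hS]
    rw [hW, rectExpect_comp_rows (unifW P) (sum_unifW P) hS (fun ω => if R ω then (1 : ℝ) else 0), one_mul]
    exact mul_le_mul_of_nonneg_right hR (by positivity)
  · have h0 : (univ.filter fun W : Fin M → Fin n → EntryBlock P => Function.Injective S ∧ R (fun i => W (S i))) = ∅ :=
      filter_eq_empty_iff.2 fun W _ h => hS h.1
    rw [h0, card_empty, Nat.cast_zero]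
    positivity

/-- Markov's inequality for the square product law. [folklore] -/
theorem arrayExpect_indicator_le {A : Type*} [Fintype A] (p : A → ℝ) (hp : ∀ a, 0 ≤ p a)
    {F : (Fin n → Fin n → A) → ℝ} (hF : ∀ ω, 0 ≤ F ω) {a : ℝ} (ha : 0 < a) :
    arrayExpect p (fun ω => if a ≤ F ω then (1 : ℝ) else 0) ≤ arrayExpect p F / a := by
  rw [arrayExpect_eq_rectExpect, arrayExpect_eq_rectExpect]
  exact rectExpect_indicator_le p hp hF ha

open Classical in
/-- **The perturbation event**: `Z ≤ Z_η(Y_S)` for the planted block `Y_S`, fraction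
`≤ 4η²n⁶ sⁿ n!/Z²`. [cite: AaronsonArkhipovToC2013, proof of Thm. 1.3, §5.2] -/
theorem card_inj_perturb_le {η Z : ℝ} (hη : 0 ≤ η) (hηn : η * (n : ℝ) ^ 3 ≤ 1) (hZ : 0 < Z) :
    ((univ.filter fun q : (Fin n → Fin M) × (Fin M → Fin n → EntryBlock P) =>
        Function.Injective q.1 ∧ Z ≤ perturbSum η ((yMat P q.2).submatrix q.1 id)).card : ℝ) ≤
      4 * η ^ 2 * (n : ℝ) ^ 6 * ((2 * 4 ^ P.b * P.v) ^ n * n.factorial) / Z ^ 2 *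
        Fintype.card ((Fin n → Fin M) × (Fin M → Fin n → EntryBlock P)) := by
  have hE := arrayExpect_perturbSum_sq_le (unifW P) (unifW_nonneg P) (sum_unifW P) (yOf P) (sum_unifW_mul_yOf P)
    (sum_unifW_mul_norm_yOf_sq P) hη hηn
  have hmk := arrayExpect_indicator_le (unifW P) (unifW_nonneg P)
    (F := fun ω : Fin n → Fin n → EntryBlock P => perturbSum η (seedMatrix (yOf P) ω) ^ 2) (fun ω => sq_nonneg _)
    (a := Z ^ 2) (by positivity)
  have hc : 0 ≤ 4 * η ^ 2 * (n : ℝ) ^ 6 * ((2 * 4 ^ P.b * P.v) ^ n * n.factorial) / Z ^ 2 := by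
    have := (arrayExpect_nonneg (unifW_nonneg P) (F := fun ω => perturbSum η (seedMatrix (yOf P) ω) ^ 2)
      fun ω => sq_nonneg _).trans hE
    positivity
  have h := card_inj_planted_le P (M := M) (fun ω => Z ≤ perturbSum η (seedMatrix (yOf P) ω)) hc
    ((le_of_eq (by
      congr 1; ext ω
      exact if_congr (sq_le_sq₀ hZ.le (perturbSum_nonneg hη _)).symm rfl rfl)).trans
      (hmk.trans (div_le_div_of_nonneg_right hE (by positivity))))
  exact h

open Classical in
/-- **The permanent event**: `P_b ≤ |Per Y_S|²` for the planted block, fraction `≤ sⁿ n!/P_b`.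
[cite: AaronsonArkhipovToC2013, proof of Thm. 1.3, eq. (5.92) (p. 195); §7] -/
theorem card_inj_perm_le {Pb : ℝ} (hPb : 0 < Pb) :
    ((univ.filter fun q : (Fin n → Fin M) × (Fin M → Fin n → EntryBlock P) =>
        Function.Injective q.1 ∧ Pb ≤ ‖((yMat P q.2).submatrix q.1 id).permanent‖ ^ 2).card : ℝ) ≤
      (2 * 4 ^ P.b * P.v) ^ n * n.factorial / Pb * Fintype.card ((Fin n → Fin M) × (Fin M → Fin n → EntryBlock P)) := by
  have hE := arrayExpect_norm_permanent_sq_le (unifW P) (unifW_nonneg P) (sum_unifW P) (yOf P) (sum_unifW_mul_yOf P)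
    (sum_unifW_mul_norm_yOf_sq P) (n := n)
  have hmk := arrayExpect_indicator_le (unifW P) (unifW_nonneg P)
    (F := fun ω : Fin n → Fin n → EntryBlock P => ‖(seedMatrix (yOf P) ω).permanent‖ ^ 2) (fun ω => sq_nonneg _) hPb
  have hc : 0 ≤ (2 * 4 ^ P.b * P.v) ^ n * n.factorial / Pb := by
    have := (arrayExpect_nonneg (unifW_nonneg P) (F := fun ω : Fin n → Fin n → EntryBlock P =>
      ‖(seedMatrix (yOf P) ω).permanent‖ ^ 2) fun ω => sq_nonneg _).trans hE
    positivity
  have h := card_inj_planted_le P (M := M) (fun ω => Pb ≤ ‖(seedMatrix (yOf P) ω).permanent‖ ^ 2) hc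
    (hmk.trans (div_le_div_of_nonneg_right hE hPb.le))
  exact h

open Classical in
/-- **Non-injective positions**, jointly with the other data: fraction `≤ n²/M` (`M ≥ 1`). [folklore] -/
theorem card_not_injective_prod_le {β : Type*} [Fintype β] (hM : 0 < M) :
    ((univ.filter fun q : (Fin n → Fin M) × β => ¬ Function.Injective q.1).card : ℝ) ≤
      (n : ℝ) ^ 2 / M * Fintype.card ((Fin n → Fin M) × β) := by
  have h := card_filter_not_injective_div_le (n := n) hM
  rw [div_le_iff₀ (by positivity)] at h
  have hprod : (univ.filter fun q : (Fin n → Fin M) × β => ¬ Function.Injective q.1) =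
      (univ.filter fun S : Fin n → Fin M => ¬ Function.Injective S) ×ˢ (univ : Finset β) := by
    ext q; simp
  rw [hprod, card_product, Nat.cast_mul, Fintype.card_prod, Nat.cast_mul, Fintype.card_fun, Fintype.card_fin,
    Fintype.card_fin, card_univ, Nat.cast_pow]
  calc ((univ.filter fun S : Fin n → Fin M => ¬ Function.Injective S).card : ℝ) * Fintype.card β
      ≤ (n : ℝ) ^ 2 / M * (M : ℝ) ^ n * Fintype.card β := mul_le_mul_of_nonneg_right h (by positivity)
    _ = (n : ℝ) ^ 2 / M * ((M : ℝ) ^ n * Fintype.card β) := by ring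

end Literature.Computability.QuantumComplexity
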